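import Summits.QuantumAdvantage.Dequantization.GraphStateRotationCorrelators
import HarnessLib

/-!
# Marginals of the `CZ` + `Z`-rotation circuits of arXiv:2509.09033 are local
# (DEQ-E25, Lemma E25-2, consequence (a))

HONEST FRAMING: instance-level adjudication of specific advantage claims; no claim about BQP vs
BPP or the summit.

Continuation of `GraphStateRotationCorrelators` (same namespace; source arXiv:2509.09033v1,
Definition 16 / Algorithm 1, input `x = 0^n`, convention `RZ(θ) = e^{-iθZ}`).  From the closed
form `correlator_eq_prod` of every parity correlator we derive, by Walsh inversion on the sub-cube
of a wire set `T`: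
* `margProb_eq_sum_correlator` — every `k`-wire marginal `Pr[y|_T = v|_T]` is
  `2^{-k} Σ_{S ⊆ T} E[χ_S] χ_S(v)`, an inverse Walsh transform of `2^k` closed-form correlators
  (consequence (a) of Lemma E25-2 in the unit note `pub-qadeq-deq-2/DEQ-E25.md`: exact classical
  evaluation of any `k`-wire marginal in `O(2^k (n + |E|))` arithmetic operations);
* `correlator_congr_theta` / `margProb_congr_theta` — `E_θ[χ_S]` depends on `θ` only through
  `θ|_S`, hence the law of `y|_T` only through `θ|_T` (physically: the rotations outside `T` are
  diagonal, commute with the `CZ` layer and cancel in the partial trace);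
* `correlator_congr_graph` / `margProb_local` — and on `G` only through the edges meeting `T`.
These are the exact 'light-cone' statements behind the locality of the learning statistic
(S.4.13) (`probBitOne_of_isolated` of the first file; `probBitOne_eq_margProb` links the two).
Nothing here concerns sampling from the full distribution.  No `sorry`, standard axioms.
Elaboration: checked on the farm in COMBINED form (this section appended to the staged
`GraphStateRotationCorrelators.lean`, sha256[:16] 6d417597a6d1db88) because the imported module is
not yet in the tree; re-run `lean check` on this file as is once it is.  Intended tree location (to
be filed by a permitted role):
`lean/Summits/QuantumAdvantage/Dequantization/GraphStateRotationMarginals.lean`.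
-/

noncomputable section

namespace Summit.QuantumAdvantage.Dequantization.GraphStateRotationCorrelators

open Finset
open Literature.Probability.RandomGraphs.LowDegree (sgn walsh sgn_true sgn_false sgn_mul_self
  sgn_mul_sgn_of_ne)
open Literature.Computability.Cryptography (QReg)

variable {n : ℕ} (G : SimpleGraph (Fin n)) [DecidableRel G.Adj] (θ : Fin n → ℝ)

/-! ### Marginals: every `k`-wire marginal is an inverse Walsh transform of `2^k` closed-form
correlators, and sees only the angles on those wires and the edges meeting them -/

/-- The marginal law of the output on the wires `T`: `Pr[y_a = v_a for all a ∈ T]`. -/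
def margProb (T : Finset (Fin n)) (v : QReg n) : ℝ :=
  ∑ y ∈ univ.filter (fun y : QReg n => ∀ a ∈ T, y a = v a), prob G θ y

omit [DecidableRel G.Adj] in
/-- Orthogonality of characters on the sub-cube spanned by `T`:
`Σ_{S ⊆ T} χ_S(y) χ_S(v) = 2^{|T|} · [y_a = v_a for all a ∈ T]`.
[folklore; O'Donnell 2014 §1.4] -/
theorem sum_powerset_walsh_mul_walsh (T : Finset (Fin n)) (y v : QReg n) :
    ∑ S ∈ T.powerset, walsh S y * walsh S v =
      if (∀ a ∈ T, y a = v a) then (2 : ℝ) ^ T.card else 0 := by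
  have hS : ∀ S : Finset (Fin n),
      walsh S y * walsh S v = ∏ a ∈ S, (sgn (y a) * sgn (v a)) := by
    intro S; rw [walsh, walsh, ← Finset.prod_mul_distrib]
  simp_rw [hS]
  rw [← Finset.prod_one_add]
  split_ifs with h
  · rw [Finset.prod_congr rfl (fun a ha => by rw [h a ha, sgn_mul_self]), Finset.prod_const]
    norm_num
  · push Not at h
    obtain ⟨a, ha, hne⟩ := h
    exact Finset.prod_eq_zero ha (by rw [sgn_mul_sgn_of_ne hne]; norm_num)

/-- **Every `k`-wire marginal is the inverse Walsh transform of the `2^k` sub-parity correlators**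
(DEQ-E25, Lemma E25-2, consequence (a)): `Pr[y|_T = v|_T] = 2^{-|T|} Σ_{S ⊆ T} E[χ_S] χ_S(v)`,
each `E[χ_S]` being the closed-form product of `correlator_eq_prod`. -/
theorem margProb_eq_sum_correlator (T : Finset (Fin n)) (v : QReg n) :
    margProb G θ T v = (∑ S ∈ T.powerset, correlator G θ S * walsh S v) / 2 ^ T.card := by
  have h2 : (2 : ℝ) ^ T.card ≠ 0 := by positivity
  rw [eq_div_iff h2, margProb, Finset.sum_filter]
  calc (∑ y, if (∀ a ∈ T, y a = v a) then prob G θ y else 0) * (2 : ℝ) ^ T.card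
      = ∑ y, prob G θ y * (if (∀ a ∈ T, y a = v a) then (2 : ℝ) ^ T.card else 0) := by
        rw [Finset.sum_mul]
        refine Finset.sum_congr rfl fun y _ => ?_
        split_ifs <;> ring
    _ = ∑ y, prob G θ y * ∑ S ∈ T.powerset, walsh S y * walsh S v := by
        refine Finset.sum_congr rfl fun y _ => ?_
        rw [sum_powerset_walsh_mul_walsh]
    _ = ∑ S ∈ T.powerset, correlator G θ S * walsh S v := by
        simp_rw [Finset.mul_sum, correlator, Finset.sum_mul]
        rw [Finset.sum_comm]
        refine Finset.sum_congr rfl fun S _ => Finset.sum_congr rfl fun y _ => ?_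
        ring

/-- `Pr[y_a = 1]` is the one-wire marginal. -/
theorem probBitOne_eq_margProb (a : Fin n) :
    probBitOne G θ a = margProb G θ {a} (fun _ => true) := by
  unfold probBitOne margProb
  refine Finset.sum_congr ?_ fun _ _ => rfl
  ext y
  simp only [Finset.mem_filter, Finset.mem_univ, true_and, Finset.mem_singleton, forall_eq]

/-- The wire factor of `a` depends on `θ` only through `θ_a`, and not at all when `a ∉ S`. -/
theorem wire_congr_theta {θ₁ θ₂ : Fin n → ℝ} {S : Finset (Fin n)} {a : Fin n}
    (h : a ∈ S → θ₁ a = θ₂ a) : wire G θ₁ S a = wire G θ₂ S a := by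
  unfold wire
  by_cases ha : a ∈ S
  · rw [if_pos ha, if_pos ha, h ha]
  · rw [if_neg ha, if_neg ha]

/-- **Angle locality of the parity correlators**: `E_θ[χ_S]` depends on `θ` only through `θ|_S`
(the rotations outside `S` commute with the `CZ` layer and cancel in `\bar f(z) f(z ⊕ 1_S)`). -/
theorem correlator_congr_theta {θ₁ θ₂ : Fin n → ℝ} {S : Finset (Fin n)}
    (h : ∀ a ∈ S, θ₁ a = θ₂ a) : correlator G θ₁ S = correlator G θ₂ S := by
  have e := correlator_eq_prod G θ₁ S
  rw [Finset.prod_congr rfl (fun a _ => wire_congr_theta G (S := S) (a := a) (h a)),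
    ← correlator_eq_prod G θ₂ S] at e
  exact_mod_cast e

/-- **Angle locality of the marginals** (the 'light cone' of the learning statistic): the law of
`y|_T` depends on `θ` only through `θ|_T`. -/
theorem margProb_congr_theta {θ₁ θ₂ : Fin n → ℝ} {T : Finset (Fin n)}
    (h : ∀ a ∈ T, θ₁ a = θ₂ a) (v : QReg n) :
    margProb G θ₁ T v = margProb G θ₂ T v := by
  have h2 : (2 : ℝ) ^ T.card ≠ 0 := by positivity
  rw [margProb_eq_sum_correlator, margProb_eq_sum_correlator, div_left_inj' h2]
  exact Finset.sum_congr rfl fun S hS => by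
    rw [correlator_congr_theta G (fun a ha => h a (Finset.mem_powerset.1 hS ha))]

/-- `m_a(S)` sees only the edges with an endpoint in `S`. -/
theorem nbrIn_congr_graph {G₁ G₂ : SimpleGraph (Fin n)} [DecidableRel G₁.Adj]
    [DecidableRel G₂.Adj] {S : Finset (Fin n)}
    (h : ∀ a, ∀ b ∈ S, (G₁.Adj a b ↔ G₂.Adj a b)) (a : Fin n) :
    nbrIn G₁ S a = nbrIn G₂ S a := by
  unfold nbrIn
  congr 1
  ext b
  simp only [Finset.mem_filter, Finset.mem_univ, true_and]
  exact ⟨fun hb => ⟨(h a b hb.2).1 hb.1, hb.2⟩, fun hb => ⟨(h a b hb.2).2 hb.1, hb.2⟩⟩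

/-- `e(S)` sees only the edges with an endpoint in `S`. -/
theorem edgesIn_congr_graph {G₁ G₂ : SimpleGraph (Fin n)} [DecidableRel G₁.Adj]
    [DecidableRel G₂.Adj] {S : Finset (Fin n)}
    (h : ∀ a, ∀ b ∈ S, (G₁.Adj a b ↔ G₂.Adj a b)) :
    edgesIn G₁ S = edgesIn G₂ S := by
  unfold edgesIn
  congr 1
  ext p
  simp only [Finset.mem_filter, Finset.mem_univ, true_and]
  exact ⟨fun hp => ⟨hp.1, (h p.1 p.2 hp.2.2.2).1 hp.2.1, hp.2.2⟩,
    fun hp => ⟨hp.1, (h p.1 p.2 hp.2.2.2).2 hp.2.1, hp.2.2⟩⟩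

/-- **Graph locality of the parity correlators**: `E[χ_S]` depends on `G` only through the edges
meeting `S`. -/
theorem correlator_congr_graph {G₁ G₂ : SimpleGraph (Fin n)} [DecidableRel G₁.Adj]
    [DecidableRel G₂.Adj] {S : Finset (Fin n)}
    (h : ∀ a, ∀ b ∈ S, (G₁.Adj a b ↔ G₂.Adj a b)) :
    correlator G₁ θ S = correlator G₂ θ S := by
  have e := correlator_eq_prod G₁ θ S
  have hw : ∀ a, wire G₁ θ S a = wire G₂ θ S a := fun a => by
    unfold wire; rw [nbrIn_congr_graph h a]
  rw [edgesIn_congr_graph h, Finset.prod_congr rfl (fun a _ => hw a),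
    ← correlator_eq_prod G₂ θ S] at e
  exact_mod_cast e

/-- **Locality of the marginals**: the law of `y|_T` is determined by `θ|_T` and the edges of `G`
meeting `T` — it is the same for any two circuits of the family agreeing there. -/
theorem margProb_local {G₁ G₂ : SimpleGraph (Fin n)} [DecidableRel G₁.Adj]
    [DecidableRel G₂.Adj] {θ₁ θ₂ : Fin n → ℝ} {T : Finset (Fin n)}
    (hθ : ∀ a ∈ T, θ₁ a = θ₂ a)
    (hG : ∀ a, ∀ b ∈ T, (G₁.Adj a b ↔ G₂.Adj a b)) (v : QReg n) :
    margProb G₁ θ₁ T v = margProb G₂ θ₂ T v := by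
  have h2 : (2 : ℝ) ^ T.card ≠ 0 := by positivity
  rw [margProb_congr_theta G₁ hθ v, margProb_eq_sum_correlator, margProb_eq_sum_correlator,
    div_left_inj' h2]
  exact Finset.sum_congr rfl fun S hS => by
    rw [correlator_congr_graph θ₂ (fun a b hb => hG a b (Finset.mem_powerset.1 hS hb))]

end Summit.QuantumAdvantage.Dequantization.GraphStateRotationCorrelators

end
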